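import Summits.QuantumFields.YangMills.Theorems.PencilRigidityHypercubicLimitDefs
import Summits.QuantumFields.YangMills.Theorems.PencilRigidityHypercubicLimitDefsB
import Summits.QuantumFields.YangMills.Theorems.MirrorModularBoostsHypercubicLimitPeelRpFamDefs
import Summits.QuantumFields.YangMills.Theorems.MirrorModularBoostsHypercubicLimitPeelReflHermRP
import Summits.QuantumFields.YangMills.Theorems.PencilRigidityHypercubicLimitRpBlockLatticeDistPerm
import Summits.QuantumFields.YangMills.Theorems.PencilRigidityHypercubicLimitRpBlockThetaInvariance
import Summits.QuantumFields.YangMills.Theorems.PencilRigidityHypercubicLimitRpBlockSignedPermGeneration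
import HarnessLib

/-!
# Crux `HypercubicLimit` (stmt-QuantumFields-16154), line `peel-and-disseminate`: (R2) proper-hypercubic invariance of the one-field limits

Support file (c3 seat) proving the registered piece (R2) `stub_reflHypercubic` of the host closure's reflection
leg (R) `ReflectionLegsP` (crux stmt-QuantumFields-8646, line `conditional-mean-telescoping`, vocabulary
`PencilRigidityHypercubicLimitDefs(B).lean`): for every `(G, r)` with `GapData` there is a torus demand `Λ`
(the demand `rhDemand m` of (R1): `L ≥ max (1, m(β)⁻²)`, i.e. `L_k ≥ a_k⁻²` in units `a = m(β)`) such that for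
every `SoftData` witness obeying it and `PolyRenorm`, the one-field limit `S₁` is invariant on `⁰𝒮` under the
diagonal action `linActMulti R` of every linear isometry `R` of `ℝ⁴` mapping each axis vector `eᵢ` to some `±eⱼ`
(the hyperoctahedral group; the registered statement asks only for its determinant-one part, whose hypothesis is
therefore idle).

Route (the 8646-c1 seat's plan, `Cruxes/HypercubicLimit/CONSULT-c1-softdata.md`; all inputs landed):
* **coordinate permutations** (`coordPerm_of_softData`, §1): the curvature's renormalised lattice distribution
  `(c_k a_k⁴)ⁿ latticeDist` is EXACTLY invariant under `linActMulti (piLpCongrLeft 2 ℝ ℝ π)`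
  (`rpBlock_latticeDistPerm`: the box, the six plaquette orientations and Wilson's torus measure are
  `π`-invariant), it converges to `S₁ n` on `⁰𝒮` (`SoftData`'s density clause) and `⁰𝒮` is `linActMulti`-stable
  (`isOffDiagonal_linActMulti`); limits are unique.  No demand is used here.
* **time reflection** (`thetaInv_of_torusBound`, §1): the RP-adapted lattice family `rpFam` of the scheme
  (`MirrorModularBoostsHypercubicLimitPeelRpFamDefs.lean`) is EXACTLY `Θ`-invariant (`rpFam_thetaMulti` ←
  `rpBlock_thetaInvariance`: corner-reflection reindexing + `Θ`-invariance of Wilson's torus state) and converges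
  to `S₁` on `⁰𝒮` (`tendsto_rpFam` of `MirrorModularBoostsHypercubicLimitPeelReflHermRP.lean`, which consumes
  `a_k → 0`, eventually `a_k⁻² ≤ L_k` — the demand —, `PolyRenorm`, the plane expansion and the shifted uniform
  bound of `SoftData`); `⁰𝒮` is `Θ`-stable (`IsOffDiagonal.thetaMulti`); limits are unique.
* **generation** (§2): `rpBlock_signedPermGeneration` — an axis reflection is `P_{(0 i)} ∘ Θ ∘ P_{(0 i)}`, an
  axis-permuting isometry is a sign change followed by a coordinate permutation.

Refs: OsterwalderSchrader1973 §2 (Euclidean covariance on `⁰𝒮`); OsterwalderSeiler1978 §§2–3 (lattice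
symmetries of Wilson's action); GlimmJaffe1987 §6.1; `PencilRigidityHypercubicLimitDefs.lean` §7.
-/

set_option autoImplicit false
noncomputable section
open scoped SchwartzMap ENNReal
open MeasureTheory Filter Topology
open Literature.MathematicalPhysics.AQFT Literature.MathematicalPhysics.QuantumLattice
open Literature.MathematicalPhysics.QuantumFieldTheory
open Literature.Probability.LatticeModels (box Site)
open Summit.QuantumFields.YangMills.Cruxes.HypercubicLimit.ConditionalMeanTelescoping
open Summit.QuantumFields.YangMills.Theorems.OSLegsFromFemtoAndGap (latticeDist)
open Summit.QuantumFields.YangMills.Theorems.OSLegsFromFemtoAndGap.Upgrade (isOffDiagonal_linActMulti)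

namespace Summit.QuantumFields.YangMills.Cruxes.HypercubicLimit.PeelAndDisseminate

/-! ## §1 The two generators: coordinate permutations and the time reflection -/

section Generators

variable {G : Type} [Group G] [TopologicalSpace G] [IsTopologicalGroup G] [CompactSpace G]
  [MeasurableSpace G] [BorelSpace G]

/-- **The RP-adapted family is exactly `Θ`-invariant** (host block `rpBlock_thetaInvariance`, for every test
function). -/
theorem rpFam_thetaMulti (r : LatticeRep G) (β : ℝ) (L : ℕ) (a lam : ℝ) (n : ℕ)
    (F : 𝓢((Fin n → EuclideanSpace ℝ (Fin 4)), ℂ)) :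
    rpFam r β L a lam n (thetaMulti 4 F) = rpFam r β L a lam n F :=
  rpBlock_thetaInvariance G r β L a lam (fun q => wilsonTorusMean r.ρ β L (planeObs r q.1)) n F

/-- **Coordinate-permutation invariance of the one-field limit on `⁰𝒮`** from `SoftData` alone: the
renormalised lattice distributions of the curvature converge to `S₁ n` on `⁰𝒮` (density clause) and are
exactly invariant under `linActMulti (piLpCongrLeft 2 ℝ ℝ π)` (`rpBlock_latticeDistPerm`); the permuted test
function is still off-diagonal (`isOffDiagonal_linActMulti`), and limits are unique. -/
theorem coordPerm_of_softData (r : LatticeRep G) {m : ℝ → ℝ} {δ₀ : ℝ} {Λ : ℝ → ℕ → ℕ}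
    {sch : SpeciesScheme (YMSpecies G)} {S₁ : SchwingerFamily (EuclideanSpace ℝ (Fin 4))}
    {Spl : (n : ℕ) → (Fin n → Fin 4 × Fin 4) → (𝓢((Fin n → EuclideanSpace ℝ (Fin 4)), ℂ) →L[ℂ] ℂ)}
    (hD : SoftData r m δ₀ Λ sch S₁ Spl) (π : Equiv.Perm (Fin 4)) (n : ℕ)
    (F : 𝓢((Fin n → EuclideanSpace ℝ (Fin 4)), ℂ)) (hF : IsOffDiagonal F) :
    S₁ n (linActMulti (LinearIsometryEquiv.piLpCongrLeft 2 ℝ ℝ π) F) = S₁ n F := by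
  obtain ⟨-, -, -, -, -, -, -, hdens, -⟩ := hD
  refine tendsto_nhds_unique (hdens n _ (isOffDiagonal_linActMulti _ hF)) ?_
  simp only [rpBlock_latticeDistPerm]
  exact hdens n F hF

/-- **Time-reflection invariance of the one-field limit on `⁰𝒮`**, for a `SoftData` witness with `PolyRenorm`
whose tori eventually obey `a_k⁻² ≤ L_k`: the RP-adapted family of the scheme converges to `S₁` on `⁰𝒮`
(`tendsto_rpFam`; `a_k = m(β_k) → 0`, `a_k > 0` eventually by `GapData` (i)–(ii) and `β_k → ∞`), it is exactly
`Θ`-invariant (`rpFam_thetaMulti`), `Θ F ∈ ⁰𝒮` (`IsOffDiagonal.thetaMulti`), and limits are unique. -/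
theorem thetaInv_of_torusBound (r : LatticeRep G) {β₁ C₁ c₂ : ℝ} {m : ℝ → ℝ}
    (hgap : GapData G r β₁ C₁ c₂ m) {Λ : ℝ → ℕ → ℕ} {δ₀ : ℝ} {sch : SpeciesScheme (YMSpecies G)}
    {S₁ : SchwingerFamily (EuclideanSpace ℝ (Fin 4))}
    {Spl : (n : ℕ) → (Fin n → Fin 4 × Fin 4) → (𝓢((Fin n → EuclideanSpace ℝ (Fin 4)), ℂ) →L[ℂ] ℂ)}
    (hD : SoftData r m δ₀ Λ sch S₁ Spl) (hP : PolyRenorm r sch)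
    (hL2 : ∀ᶠ k in atTop, (sch.a k)⁻¹ * (sch.a k)⁻¹ ≤ (sch.L k : ℝ)) (n : ℕ)
    (F : 𝓢((Fin n → EuclideanSpace ℝ (Fin 4)), ℂ)) (hF : IsOffDiagonal F) :
    S₁ n (thetaMulti 4 F) = S₁ n F := by
  obtain ⟨hunits, hβ, -, -, hc, -, hSpl, -, hexp, hS0, hS1, ⟨K, γ, s, hK, hUB, -, -⟩, -, -⟩ := hD
  obtain ⟨Q, hQ⟩ := hP
  have ha0 : Tendsto sch.a atTop (𝓝 0) := (hgap.2.1.comp hβ).congr fun k => (hunits k).symm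
  have hapos : ∀ᶠ k in atTop, 0 < sch.a k :=
    (hβ.eventually_ge_atTop β₁).mono fun k hk => by rw [hunits k]; exact hgap.1 _ hk
  have hc0 : ∀ k, 0 ≤ sch.c r.curvature k := fun k => by
    rw [hc k]; exact inv_nonneg.2 (Real.sqrt_nonneg _)
  have hconv := tendsto_rpFam r sch S₁ Spl hK ha0 hapos hL2 hc0 hQ hSpl hexp hS0 hS1 hUB
  refine tendsto_nhds_unique (hconv n (thetaMulti 4 F) hF.thetaMulti) ?_
  simp only [rpFam_thetaMulti]
  exact hconv n F hF

/-- **Signed-permutation invariance with an explicit torus lower bound.**  For every `SoftData` witness with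
`PolyRenorm` whose tori eventually obey `a_k⁻² ≤ L_k`, the one-field limit `S₁` is invariant on `⁰𝒮` under
`linActMulti R` for every linear isometry `R` of `ℝ⁴` mapping each axis vector to a signed axis vector
(`coordPerm_of_softData` + `thetaInv_of_torusBound` + `rpBlock_signedPermGeneration`). -/
theorem signedPerm_of_torusBound (r : LatticeRep G) {β₁ C₁ c₂ : ℝ} {m : ℝ → ℝ}
    (hgap : GapData G r β₁ C₁ c₂ m) {Λ : ℝ → ℕ → ℕ} {δ₀ : ℝ} {sch : SpeciesScheme (YMSpecies G)}
    {S₁ : SchwingerFamily (EuclideanSpace ℝ (Fin 4))}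
    {Spl : (n : ℕ) → (Fin n → Fin 4 × Fin 4) → (𝓢((Fin n → EuclideanSpace ℝ (Fin 4)), ℂ) →L[ℂ] ℂ)}
    (hD : SoftData r m δ₀ Λ sch S₁ Spl) (hP : PolyRenorm r sch)
    (hL2 : ∀ᶠ k in atTop, (sch.a k)⁻¹ * (sch.a k)⁻¹ ≤ (sch.L k : ℝ)) (n : ℕ)
    (R : EuclideanSpace ℝ (Fin 4) ≃ₗᵢ[ℝ] EuclideanSpace ℝ (Fin 4))
    (hR : ∀ i : Fin 4, ∃ j : Fin 4, R (EuclideanSpace.single i 1) = EuclideanSpace.single j 1 ∨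
      R (EuclideanSpace.single i 1) = -EuclideanSpace.single j 1)
    (F : 𝓢((Fin n → EuclideanSpace ℝ (Fin 4)), ℂ)) (hF : IsOffDiagonal F) :
    S₁ n (linActMulti R F) = S₁ n F :=
  rpBlock_signedPermGeneration n (S₁ n) (fun π F hF => coordPerm_of_softData r hD π n F hF)
    (fun F hF => thetaInv_of_torusBound r hgap hD hP hL2 n F hF) R hR F hF

end Generators

/-! ## §2 (R2) Proper-hypercubic invariance of the one-field limits of the host closure -/

/-- **(R2) Proper-hypercubic invariance of the one-field limits of the host closure on `⁰𝒮`.**  For every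
`(G, r)` with gap data there is a torus demand `Λ` (`rhDemand m`: `L ≥ max (1, m(β)⁻²)`) such that for every
`SoftData` witness obeying it and `PolyRenorm`, the one-field limit `S₁` is invariant on `⁰𝒮` under the
diagonal action of every linear isometry of `ℝ⁴` mapping each axis vector `eᵢ` to some `±eⱼ` (in particular the
determinant-one ones): coordinate permutations act exactly on the lattice distributions
(`rpBlock_latticeDistPerm`), the time reflection exactly on the RP-adapted family (`rpBlock_thetaInvariance`),
both families converge to `S₁` on `⁰𝒮` (`SoftData`, `tendsto_rpFam`), and the two generate the hyperoctahedral
group (`rpBlock_signedPermGeneration`). -/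
theorem stub_reflHypercubic : ∀ (G : Type) [Group G] [TopologicalSpace G] [IsTopologicalGroup G]
    [CompactSpace G] [MeasurableSpace G] [BorelSpace G], IsCompactSimpleLieGroup G →
    ∀ (r : LatticeRep G) (β₁ C₁ c₂ : ℝ) (m : ℝ → ℝ), GapData G r β₁ C₁ c₂ m → ∃ Λ : ℝ → ℕ → ℕ,
    ∀ (δ₀ : ℝ) (sch : SpeciesScheme (YMSpecies G)) (S₁ : SchwingerFamily (EuclideanSpace ℝ (Fin 4)))
    (Spl : (n : ℕ) → (Fin n → Fin 4 × Fin 4) → (𝓢((Fin n → (EuclideanSpace ℝ (Fin 4))), ℂ) →L[ℂ] ℂ)),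
    0 < δ₀ → SoftData r m δ₀ Λ sch S₁ Spl → PolyRenorm r sch →
    ∀ (n : ℕ) (k : Fin n → Unit) (R : (EuclideanSpace ℝ (Fin 4)) ≃ₗᵢ[ℝ] (EuclideanSpace ℝ (Fin 4))),
    LinearMap.det (R.toLinearEquiv : (EuclideanSpace ℝ (Fin 4)) →ₗ[ℝ] (EuclideanSpace ℝ (Fin 4))) = 1 →
    (∀ i : Fin 4, ∃ j : Fin 4, R (EuclideanSpace.single i 1) = EuclideanSpace.single j 1 ∨
      R (EuclideanSpace.single i 1) = -EuclideanSpace.single j 1) →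
    ∀ F : 𝓢((Fin n → (EuclideanSpace ℝ (Fin 4))), ℂ), IsOffDiagonal F →
    S₁.toLabelled n k (linActMulti R F) = S₁.toLabelled n k F := by
  intro G _ _ _ _ _ _ _ r β₁ C₁ c₂ m hgap
  refine ⟨rhDemand m, fun δ₀ sch S₁ Spl _ hD hP n k R _ hR F hF => ?_⟩
  have hΛ : ∀ k, rhDemand m (sch.β k) k ≤ sch.L k := hD.2.2.1
  have hunits : ∀ k, sch.a k = m (sch.β k) := hD.1
  have hL2 : ∀ k, (sch.a k)⁻¹ * (sch.a k)⁻¹ ≤ (sch.L k : ℝ) := fun k => by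
    rw [hunits k]
    calc (m (sch.β k))⁻¹ * (m (sch.β k))⁻¹ ≤ (⌈(m (sch.β k))⁻¹ * (m (sch.β k))⁻¹⌉₊ : ℝ) := Nat.le_ceil _
      _ ≤ (rhDemand m (sch.β k) k : ℝ) := by
          unfold rhDemand
          exact_mod_cast le_max_right _ _
      _ ≤ sch.L k := by exact_mod_cast hΛ k
  rw [SchwingerFamily.toLabelled_apply]
  exact signedPerm_of_torusBound r hgap hD hP (Eventually.of_forall hL2) n R hR F hF

end Summit.QuantumFields.YangMills.Cruxes.HypercubicLimit.PeelAndDisseminate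

end
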